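import Summits.QuantumAdvantage.QuantumAdvantage.Theorems.NearExactIsExact.Negative.TypeOOneTwentyOnePrepFourteen
import Summits.QuantumAdvantage.QuantumAdvantage.Theorems.NearExactIsExact.Negative.TypeOFourierCoreFourteen
import Summits.QuantumAdvantage.QuantumAdvantage.Theorems.NearExactIsExact.Negative.TypeTFalseFourteen
import Summits.QuantumAdvantage.QuantumAdvantage.Theorems.CubicForrelationNearExactIsExactSecondWeightAll

/-!
# A type-O side caps the forrelation at `121/128` on 14 bits (NearExactIsExact, disprover gen 25)

Negative/structural theorem for the crux `CubicForrelation.NearExactIsExact` (item r2), finite slice `n = 14`.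
HONEST FRAMING: value = THEOREM about cubic Boolean functions on 14 bits — NOT summit progress; no violation of
`NearExactIsExact`, no per-`n` value of `θ`, nothing about the asymptotic constant.

State of the `n = 14` window before this file: `θ₁₄ ∈ [57/64, 61/64)` (`…Negative.SixtyOneNotAttainedFourteen`), and a
TYPE-O side (`W_g = 32u`, all `u(x)` odd) caps `Φ ≤ 61/64` (`…Negative.TypeOSixtyOneFourteen`).  This file lowers the type-O
cap to `121/128`:
* `typeO_forrelation_le_121` (THEOREM TypeO121): cubic `f, g` on 14 bits, `g` of type O ⇒ `Φ(f,g) ≤ 121/128`;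
* `no_typeO_above_121`, `window_121_levelSix_pair`: a cubic pair with `121/128 < Φ(f,g) < 1` has BOTH sides at level 6 proper
  (`W = 64u'` with some `u'` odd).  So every value a cubic pair on 14 bits takes in `(121/128, 61/64)` — if any — comes from a
  level-6 × level-6 pair; the type-O branch of the open window `(57/64, 61/64)` is closed above `121/128`.
Mechanism (new relative to gen 24, which needed tightness `#E = 2¹⁰` AND slack `0`): with slack `σ = 2¹⁹(1 − Φ) − 24576 < 4096`
the digit set `E = {d₁ = d₂}` still has exactly `2¹⁰` points (second weight of `RM(4,14)`, `sw_second_weight_all`), so it is a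
minimum-weight word and all its differences are periods (`tf_period_of_min_weight`), which kill the Pfaffian of the quadratic
digit (`pp_period_pf`; the mod-8 congruence `to_mod_eight` holds for EVERY type-O side); rank 2 is excluded by `fo_lowrank_false`;
in the radical case the Fourier core `to_core` (Wiener–Khinchin for `(−1)^{d₁}`, integrality `k² ≠ 2²⁵`, `R = a₀ ⊕ E`) pins the
transform of the mod-8 representative `F₀` of the residual `F = u − 4(−1)^f` to `{0, ±8192}` with exactly six non-zero frequencies;
the `ℓ¹` slack bound `Σ|F − F₀| ≤ σ/2 < 2048` transports this to `|F̂| > 6144` at six frequencies, which no cubic partner affords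
(`to_partner_typeO`: type O costs `> 28672`; `to_partner_levelSix`: level 6 costs `> 7168`; `fo_levelSeven`: level `≥ 7` is exact
or bent).

Sources: [this work]; R. O'Donnell (2014) §3.3 (characters, Parseval); F. J. MacWilliams, N. J. A. Sloane (1977) Ch. 13 §4
(minimum-weight words of RM codes), Ch. 15 §2 (second-order RM codes, symplectic forms).  Standard axioms only.
-/

set_option linter.dupNamespace false -- D-0017: single-problem summit ⇒ `QuantumAdvantage.QuantumAdvantage` by design

noncomputable section

namespace Summit.QuantumAdvantage.QuantumAdvantage.Theorems.NearExactIsExact.Negative.TypeOOneTwentyOneFourteen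

open Finset
open Literature.Computability.QuantumComplexity
open Literature.Computability.QuantumComplexity.BuzetChailloux (bxor zeroVec bxor_bxor_cancel_left bxor_zeroVec zeroVec_bxor
  bxor_comm bxor_self signOf_sq)
open Literature.Computability.QuantumComplexity.DerivativeWalsh (W dwt sum_W_sq twist_bxor_left sum_char_subspace W_mul_W_bxor)
open Summit.QuantumAdvantage.QuantumAdvantage.Theorems.CubicForrelation.NearExactIsExact
open Summit.QuantumAdvantage.QuantumAdvantage.Theorems.SignedCubicForrelationNotPrBPP.Negative.HalfQuad (forrelation_comm)
open Summit.QuantumAdvantage.QuantumAdvantage.Theorems.NearExactIsExact.Negative.CaseAFrameFreeFourteen (caseA_forrelation_le)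
open Summit.QuantumAdvantage.QuantumAdvantage.Theorems.NearExactIsExact.Negative.PfaffianPeriodFourteen (pp_period_pf)
open Summit.QuantumAdvantage.QuantumAdvantage.Theorems.NearExactIsExact.Negative.TypeTFalseFourteen
  (tf_period_of_min_weight tf_rank_two_card)
open Summit.QuantumAdvantage.QuantumAdvantage.Theorems.NearExactIsExact.Negative.LevelSixSixtyOnePrep (lsp_W_diff_le)
open Summit.QuantumAdvantage.QuantumAdvantage.Theorems.NearExactIsExact.Negative.TypeOOneTwentyOnePrepFourteen
open Summit.QuantumAdvantage.QuantumAdvantage.Theorems.NearExactIsExact.Negative.TypeOFourierCoreFourteen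

/-! ### THEOREM TypeO121 -/

set_option maxHeartbeats 1600000 in
/-- **THEOREM TypeO121.**  For cubic `f, g` on `14` bits with `g` of type O (`W_g = 32u`, every `u(x)` odd): `Φ(f,g) ≤ 121/128`.
Proof.  `E = {d₁ = d₂}` empty is case A (`59/64`).  Else `#E ≥ 2¹⁰` and the budget `Σ(u − 4(−1)^f)² = 2¹⁹(1 − Φ) ≥ 2¹⁴ + 8#E`
gives `Φ ≤ 121/128` unless `#E < 1536`, i.e. (no `RM(4,14)` weight in `(d, 1.5d)`) `#E = 2¹⁰`: a minimum-weight word, so every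
difference of two points of `E` is a period of `1_E`, hence (`pp_period_pf`) kills the Pfaffian of the quadratic digit.  A difference
outside the radical makes the form rank `2` (`tf_rank_two_card`, excluded by `fo_lowrank_false`); all differences inside the radical is
the Fourier core `to_core`: the mod-8 representative `F₀` of the residual `F = u − 4(−1)^f` has `F̂₀ ∈ {0, ±8192}`, non-zero at exactly
`6` frequencies, while `Σ|F − F₀| ≤ (2¹⁹(1 − Φ) − 24576)/2 < 2048`; so `|F̂| > 6144` at `6` frequencies, which no cubic partner `f`
affords: type O costs `> 28672 > 2¹⁹(1 − Φ)` (`to_partner_typeO`), level 6 costs `> 7168 > 2¹⁷(1 − Φ)` (`to_partner_levelSix`),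
level `≥ 7` gives `Φ ∈ {1, 15/16}` (`fo_levelSeven`).  Finite-slice statement; NOT summit progress. [this work] -/
theorem typeO_forrelation_le_121 (f g : (Fin (7 + 7) → Bool) → Bool) (hf : IsDegLeFun 3 f) (hg : IsDegLeFun 3 g)
    (u : (Fin (7 + 7) → Bool) → ℤ) (hu : ∀ x, W (fun y => signOf (g y)) x = (2 : ℝ) ^ 5 * (u x : ℝ))
    (hodd : ∀ x, Odd (u x)) : forrelation f g ≤ 121 / 128 := by
  classical
  by_cases hE : ∃ x, (Odd (u x / 2) ↔ Odd (u x / 2 / 2))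
  swap
  · exact (caseA_forrelation_le f g hf hg u hu hodd fun x h => hE ⟨x, h⟩).trans (by norm_num)
  by_contra hΦ
  push Not at hΦ
  have hΦ15 : (15 / 16 : ℝ) ≤ forrelation f g := by linarith
  -- digits and the set `E = {d₁ = d₂}`
  have hq : IsDegLeFun 2 (fun x => decide (Odd (u x / 2))) := fd_digitOne g u hg hu
  have hd2 : IsDegLeFun 4 (fun x => decide (Odd (u x / 2 / 2))) := fd_digitTwo g u hg hu
  have he4 : IsDegLeFun (3 + 1) (fun x => decide (Odd (u x / 2) ↔ Odd (u x / 2 / 2))) := by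
    have h := tb_isDegLeFun_xor_const (bb_isDegLeFun_bxor (hq.mono (by norm_num)) hd2) true
    have hfun : (fun x => (decide (Odd (u x / 2)) ^^ decide (Odd (u x / 2 / 2))) ^^ true) =
        (fun x => decide (Odd (u x / 2) ↔ Odd (u x / 2 / 2))) := by
      funext x
      by_cases h1 : Odd (u x / 2) <;> by_cases h2 : Odd (u x / 2 / 2) <;> simp [h1, h2]
    rw [hfun] at h
    exact h
  have hsupp : (univ.filter fun x : Fin (7 + 7) → Bool => decide (Odd (u x / 2) ↔ Odd (u x / 2 / 2)) = true) =
      univ.filter fun x => (Odd (u x / 2) ↔ Odd (u x / 2 / 2)) :=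
    filter_congr fun x _ => by rw [decide_eq_true_iff]
  -- the budget `Σ (u − 4s)² = 2¹⁹(1 − Φ) < 28672`, pointwise `≥ 1 + 8·1_E`
  have hbud := fl_budget5 f g u hu
  have hBlt : (∑ x, (u x - 4 * sZ (f x)) ^ 2 : ℤ) < 28672 := by
    have h : ((∑ x, (u x - 4 * sZ (f x)) ^ 2 : ℤ) : ℝ) < 28672 := by
      rw [hbud]; norm_num at hΦ ⊢; linarith
    exact_mod_cast h
  have hsumE : (∑ x, (if (Odd (u x / 2) ↔ Odd (u x / 2 / 2)) then 1 else 0 : ℤ)) =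
      #(univ.filter fun x : Fin (7 + 7) → Bool => (Odd (u x / 2) ↔ Odd (u x / 2 / 2))) := by
    rw [sum_boole]
  have hpt : ∀ x, 1 + 8 * (if (Odd (u x / 2) ↔ Odd (u x / 2 / 2)) then 1 else 0 : ℤ) ≤ (u x - 4 * sZ (f x)) ^ 2 :=
    fun x => tw12_pt (u x) (sZ (f x)) (hodd x) (tp_sZ_cases (f x))
  have hlow : (16384 : ℤ) + 8 * #(univ.filter fun x : Fin (7 + 7) → Bool => (Odd (u x / 2) ↔ Odd (u x / 2 / 2))) ≤
      ∑ x, (u x - 4 * sZ (f x)) ^ 2 := by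
    have h := sum_le_sum fun x (_ : x ∈ (univ : Finset (Fin (7 + 7) → Bool))) => hpt x
    rw [sum_add_distrib, ← mul_sum, hsumE, sum_const, card_univ, Fintype.card_fun, Fintype.card_bool,
      Fintype.card_fin] at h
    norm_num at h
    linarith
  have hΦlt1 : forrelation f g < 1 := by
    have h0 : (0 : ℤ) ≤ #(univ.filter fun x : Fin (7 + 7) → Bool => (Odd (u x / 2) ↔ Odd (u x / 2 / 2))) := by positivity
    have h16 : (16384 : ℤ) ≤ ∑ x, (u x - 4 * sZ (f x)) ^ 2 := by linarith
    have h16R : (16384 : ℝ) ≤ ((∑ x, (u x - 4 * sZ (f x)) ^ 2 : ℤ) : ℝ) := by exact_mod_cast h16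
    rw [hbud] at h16R
    norm_num at h16R
    linarith
  -- `#E = 2¹⁰` (second weight of `RM(4,14)`)
  have hElt : #(univ.filter fun x : Fin (7 + 7) → Bool => (Odd (u x / 2) ↔ Odd (u x / 2 / 2))) < 1536 := by
    have h := hlow.trans_lt hBlt
    omega
  have hne : ∃ x, decide (Odd (u x / 2) ↔ Odd (u x / 2 / 2)) = true := by
    obtain ⟨x, hx⟩ := hE
    exact ⟨x, decide_eq_true hx⟩
  have hP1024 : #(univ.filter fun x : Fin (7 + 7) → Bool => decide (Odd (u x / 2) ↔ Odd (u x / 2 / 2)) = true) = 1024 := by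
    have h := sw_second_weight_all 4 (by norm_num) (7 + 7) _ he4 hne (by rw [hsupp]; norm_num; omega)
    rw [hsupp] at h ⊢
    norm_num at h
    omega
  have hE1024 : #(univ.filter fun x : Fin (7 + 7) → Bool => (Odd (u x / 2) ↔ Odd (u x / 2 / 2))) = 1024 := by
    rw [← hsupp]; exact hP1024
  have hcardE : 2 ^ (3 + 1) * #(univ.filter fun x : Fin (7 + 7) → Bool =>
      decide (Odd (u x / 2) ↔ Odd (u x / 2 / 2)) = true) = 2 ^ (7 + 7) := by
    rw [hP1024]; norm_num
  -- every difference of two points of `E` is a period of `1_E`; the mod-8 congruence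
  have hper : ∀ a b : Fin (7 + 7) → Bool, decide (Odd (u a / 2) ↔ Odd (u a / 2 / 2)) = true →
      decide (Odd (u b / 2) ↔ Odd (u b / 2 / 2)) = true → ∀ x,
      decide (Odd (u (bxor x (bxor a b)) / 2) ↔ Odd (u (bxor x (bxor a b)) / 2 / 2)) =
        decide (Odd (u x / 2) ↔ Odd (u x / 2 / 2)) :=
    fun a b ha hb => tf_period_of_min_weight (fun x => decide (Odd (u x / 2) ↔ Odd (u x / 2 / 2))) he4 hcardE a b ha hb
  have hmod : ∀ x, (8 : ℤ) ∣ u x - 5 + 2 * (if decide (Odd (u x / 2)) = true then 1 else 0 : ℤ) +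
      4 * (if decide (Odd (u x / 2) ↔ Odd (u x / 2 / 2)) = true then 1 else 0 : ℤ) :=
    fun x => to_mod_eight (u x) (hodd x)
  by_cases hrad : ∀ a b : Fin (7 + 7) → Bool, decide (Odd (u a / 2) ↔ Odd (u a / 2 / 2)) = true →
      decide (Odd (u b / 2) ↔ Odd (u b / 2 / 2)) = true →
      ∀ y, (decide (Odd (u zeroVec / 2)) ^^ decide (Odd (u (bxor a b) / 2)) ^^ decide (Odd (u y / 2)) ^^
        decide (Odd (u (bxor (bxor a b) y) / 2))) = false
  · -- RADICAL CASE: the Fourier core and the six large frequencies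
    have hR : ¬ 2 ^ 12 ≤ #(univ.filter fun x : Fin (7 + 7) → Bool => ∀ y, (decide (Odd (u zeroVec / 2)) ^^
        decide (Odd (u x / 2)) ^^ decide (Odd (u y / 2)) ^^ decide (Odd (u (bxor x y) / 2))) = false) :=
      fun h => fo_lowrank_false f g hg u hu hodd h hE hΦ15
    have hvals := to_core (fun z => decide (Odd (u z / 2))) (fun z => decide (Odd (u z / 2) ↔ Odd (u z / 2 / 2)))
      hq hP1024 hrad hR
    -- the mod-8 representative `T = F₀` of the residual, as an integer function
    obtain ⟨T, hT⟩ : ∃ T : (Fin (7 + 7) → Bool) → ℤ, ∀ x, T x = (1 - 2 * (if Odd (u x / 2) then 1 else 0 : ℤ)) *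
        (1 - 4 * (if (Odd (u x / 2) ↔ Odd (u x / 2 / 2)) then 1 else 0 : ℤ)) := ⟨_, fun x => rfl⟩
    have hfun : (fun x => ((T x : ℤ) : ℝ)) = fun x => signOf (decide (Odd (u x / 2))) *
        (1 - 4 * (if decide (Odd (u x / 2) ↔ Odd (u x / 2 / 2)) = true then (1 : ℝ) else 0)) := by
      funext x
      rw [hT x]
      by_cases h1 : Odd (u x / 2) <;> by_cases h2 : Odd (u x / 2 / 2) <;> norm_num [h1, h2, signOf]
    have hvalsT : ∀ y, W (fun x => ((T x : ℤ) : ℝ)) y = 0 ∨ W (fun x => ((T x : ℤ) : ℝ)) y = 8192 ∨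
        W (fun x => ((T x : ℤ) : ℝ)) y = -8192 := by
      intro y; rw [hfun]; exact hvals y
    have hcostpt : ∀ x, T x ^ 2 + 2 * |(u x - 4 * sZ (f x)) - T x| ≤ (u x - 4 * sZ (f x)) ^ 2 ∧
        T x ^ 2 = 1 + 8 * (if (Odd (u x / 2) ↔ Odd (u x / 2 / 2)) then 1 else 0 : ℤ) := by
      intro x
      have h := to_cost (u x) (sZ (f x)) (hodd x) (tp_sZ_cases (f x))
      rw [hT x]
      exact ⟨h.2, h.1⟩
    have hTsq : ∑ x, T x ^ 2 = 24576 := by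
      rw [sum_congr rfl fun x _ => (hcostpt x).2, sum_add_distrib, ← mul_sum, hsumE, hE1024, sum_const, card_univ,
        Fintype.card_fun, Fintype.card_bool, Fintype.card_fin]
      norm_num
    have hl1 : (∑ x, |(u x - 4 * sZ (f x)) - T x| : ℤ) ≤ 2047 := by
      have h := sum_le_sum fun x (_ : x ∈ (univ : Finset (Fin (7 + 7) → Bool))) => (hcostpt x).1
      rw [sum_add_distrib, ← mul_sum, hTsq] at h
      omega
    have hParsT : ∑ y, W (fun x => ((T x : ℤ) : ℝ)) y ^ 2 = (2 : ℝ) ^ (7 + 7) * 24576 := by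
      rw [sum_W_sq]
      congr 1
      have h : ∑ x, ((T x : ℤ) : ℝ) ^ 2 = ((∑ x, T x ^ 2 : ℤ) : ℝ) := by push_cast; rfl
      rw [h, hTsq]
      norm_num
    have hsix := to_six_freq _ hvalsT hParsT
    have hbig : ∀ y ∈ univ.filter (fun y => W (fun x => ((T x : ℤ) : ℝ)) y ≠ 0),
        (6144 : ℝ) < |W (fun x => ((u x - 4 * sZ (f x) : ℤ) : ℝ)) y| := by
      intro y hy
      have hy' := (mem_filter.1 hy).2
      have h8 : |W (fun x => ((T x : ℤ) : ℝ)) y| = 8192 := by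
        rcases hvalsT y with h | h | h
        · exact absurd h hy'
        · rw [h]; norm_num
        · rw [h]; norm_num
      have hdiff : |W (fun x => ((u x - 4 * sZ (f x) : ℤ) : ℝ)) y - W (fun x => ((T x : ℤ) : ℝ)) y| ≤
          ((∑ x, |(u x - 4 * sZ (f x)) - T x| : ℤ) : ℝ) := lsp_W_diff_le (fun x => u x - 4 * sZ (f x)) T y
      have hl1R : ((∑ x, |(u x - 4 * sZ (f x)) - T x| : ℤ) : ℝ) ≤ 2047 := by exact_mod_cast hl1
      have htri := abs_sub_abs_le_abs_sub (W (fun x => ((T x : ℤ) : ℝ)) y) (W (fun x => ((u x - 4 * sZ (f x) : ℤ) : ℝ)) y)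
      rw [abs_sub_comm] at htri
      linarith
    -- partner dispatch on the cubic `f`
    obtain ⟨v, hv⟩ := tw_base f hf 5 (by norm_num)
    by_cases hvodd : ∀ y, Odd (v y)
    · have hbud' : ((∑ y, (v y - 4 * sZ (g y)) ^ 2 : ℤ) : ℝ) = (2 : ℝ) ^ 19 * (1 - forrelation f g) := by
        rw [forrelation_comm]; exact fl_budget5 g f v hv
      have hB' : (∑ y, (v y - 4 * sZ (g y)) ^ 2 : ℤ) < 28672 := by
        have h : ((∑ y, (v y - 4 * sZ (g y)) ^ 2 : ℤ) : ℝ) < 28672 := by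
          rw [hbud']; norm_num at hΦ ⊢; linarith
        exact_mod_cast h
      exact to_partner_typeO f g u hu v hv hvodd _ hsix hbig hB'
    · push Not at hvodd
      obtain ⟨y₀, hy₀⟩ := hvodd
      have hev : ∀ y, ¬ Odd (v y) := fun y h => hy₀ ((fd_parity_const f v hf hv y y₀).1 h)
      have hv6 := tw_level_up f v hv hev
      by_cases h6 : ∃ y, Odd (v y / 2)
      · have hbud6 : ((∑ y, (v y / 2 - 2 * sZ (g y)) ^ 2 : ℤ) : ℝ) = (2 : ℝ) ^ 17 * (1 - forrelation f g) := by
          rw [forrelation_comm]; exact fl_budget6 g f (fun y => v y / 2) hv6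
        have hB6 : (∑ y, (v y / 2 - 2 * sZ (g y)) ^ 2 : ℤ) < 7168 := by
          have h : ((∑ y, (v y / 2 - 2 * sZ (g y)) ^ 2 : ℤ) : ℝ) < 7168 := by
            rw [hbud6]; norm_num at hΦ ⊢; linarith
          exact_mod_cast h
        exact to_partner_levelSix f g hf u hu (fun y => v y / 2) hv6 h6 _ hsix hbig hB6
      · push Not at h6
        have hv7 := tw_level_up f (fun y => v y / 2) hv6 h6
        have hΦ15' : (15 / 16 : ℝ) ≤ forrelation g f := by rw [forrelation_comm]; exact hΦ15
        rcases fo_levelSeven g f hg hf _ hv7 hΦ15' with h | h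
        · rw [forrelation_comm] at h
          exact absurd h (ne_of_lt hΦlt1)
        · rw [forrelation_comm] at h
          linarith [h.2]
  · -- RANK-2 CASE: a difference outside the radical
    push Not at hrad
    obtain ⟨a, b, ha', hb', a', ha'ne⟩ := hrad
    have hBat : (decide (Odd (u zeroVec / 2)) ^^ decide (Odd (u a' / 2)) ^^ decide (Odd (u (bxor a b) / 2)) ^^
        decide (Odd (u (bxor a' (bxor a b)) / 2))) = true := by
      rw [es_B_symm (fun z => decide (Odd (u z / 2))) a' (bxor a b)]
      revert ha'ne
      cases (decide (Odd (u zeroVec / 2)) ^^ decide (Odd (u (bxor a b) / 2)) ^^ decide (Odd (u a' / 2)) ^^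
        decide (Odd (u (bxor (bxor a b) a') / 2))) <;> simp
    have hPf := fun b' c' => pp_period_pf g hg u hu (fun z => decide (Odd (u z / 2)))
      (fun z => decide (Odd (u z / 2) ↔ Odd (u z / 2 / 2))) hq hmod (bxor a b) (hper a b ha' hb') a' b' c'
    have hK := tf_rank_two_card (fun z => decide (Odd (u z / 2))) hq (bxor a b) a' hBat hPf
    have hrad12 : 2 ^ 12 ≤ #(univ.filter fun x : Fin (7 + 7) → Bool => ∀ y, (decide (Odd (u zeroVec / 2)) ^^
        decide (Odd (u x / 2)) ^^ decide (Odd (u y / 2)) ^^ decide (Odd (u (bxor x y) / 2))) = false) := by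
      norm_num at hK ⊢
      omega
    exact fo_lowrank_false f g hg u hu hodd hrad12 hE hΦ15

/-- **THEOREM TypeO121, the type-O side being `f`.**  NOT summit progress. [this work] -/
theorem typeO_forrelation_le_121' (f g : (Fin (7 + 7) → Bool) → Bool) (hf : IsDegLeFun 3 f) (hg : IsDegLeFun 3 g)
    (v : (Fin (7 + 7) → Bool) → ℤ) (hv : ∀ y, W (fun x => signOf (f x)) y = (2 : ℝ) ^ 5 * (v y : ℝ))
    (hodd : ∀ y, Odd (v y)) : forrelation f g ≤ 121 / 128 := by
  rw [forrelation_comm]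
  exact typeO_forrelation_le_121 g f hg hf v hv hodd

/-- **No type-O side above `121/128`.**  A cubic pair on `14` bits with `121/128 < Φ(f,g)` has NO type-O side: writing
`W_g = 32u_g`, `W_f = 32u_f` (Ax), some `u_g(x)` and some `u_f(y)` are even.  NOT summit progress. [this work] -/
theorem no_typeO_above_121 (f g : (Fin (7 + 7) → Bool) → Bool) (hf : IsDegLeFun 3 f) (hg : IsDegLeFun 3 g)
    (hΦ : (121 / 128 : ℝ) < forrelation f g)
    (ug uf : (Fin (7 + 7) → Bool) → ℤ) (hug : ∀ x, W (fun y => signOf (g y)) x = (2 : ℝ) ^ 5 * (ug x : ℝ))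
    (huf : ∀ y, W (fun x => signOf (f x)) y = (2 : ℝ) ^ 5 * (uf y : ℝ)) :
    (∃ x, ¬ Odd (ug x)) ∧ (∃ y, ¬ Odd (uf y)) := by
  constructor
  · by_contra h
    push Not at h
    exact absurd hΦ (not_lt.2 (typeO_forrelation_le_121 f g hf hg ug hug h))
  · by_contra h
    push Not at h
    exact absurd hΦ (not_lt.2 (typeO_forrelation_le_121' f g hf hg uf huf h))

/-- **The window `(121/128, 1)` needs two level-6 sides.**  If cubic `f, g` on `14` bits have `121/128 < Φ(f,g) < 1` then
`W_g = 64u'` and `W_f = 64v'` with some `u'(x)` odd and some `v'(y)` odd.  (So the open part `(57/64, 61/64)` of the `n = 14`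
window splits: type-O pairs can only realise values `≤ 121/128`; anything in `(121/128, 61/64)` is a level-6 × level-6 pair.)
NOT summit progress. [this work] -/
theorem window_121_levelSix_pair (f g : (Fin (7 + 7) → Bool) → Bool) (hf : IsDegLeFun 3 f) (hg : IsDegLeFun 3 g)
    (hΦ : (121 / 128 : ℝ) < forrelation f g) (hne : forrelation f g ≠ 1) :
    ∃ u' v' : (Fin (7 + 7) → Bool) → ℤ,
      (∀ x, W (fun y => signOf (g y)) x = (2 : ℝ) ^ 6 * (u' x : ℝ)) ∧ (∃ x, Odd (u' x)) ∧
      (∀ y, W (fun x => signOf (f x)) y = (2 : ℝ) ^ 6 * (v' y : ℝ)) ∧ (∃ y, Odd (v' y)) := by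
  obtain ⟨ug, hug⟩ := tw_base g hg 5 (by norm_num)
  obtain ⟨uf, huf⟩ := tw_base f hf 5 (by norm_num)
  obtain ⟨hgev, hfev⟩ := no_typeO_above_121 f g hf hg hΦ ug uf hug huf
  have hΦ' : (15 / 16 : ℝ) < forrelation f g := by linarith
  have hΦ'' : (15 / 16 : ℝ) < forrelation g f := by rw [forrelation_comm]; exact hΦ'
  have hne' : forrelation g f ≠ 1 := by rw [forrelation_comm]; exact hne
  obtain ⟨u', hu', hou'⟩ := to_even_side_levelSix f g hf hg hΦ' hne ug hug hgev
  obtain ⟨v', hv', hov'⟩ := to_even_side_levelSix g f hg hf hΦ'' hne' uf huf hfev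
  exact ⟨u', v', hu', hou', hv', hov'⟩

/-- **THEOREM TypeO121 at the type `Fin 14`.**  For cubic `f, g : (Fin 14 → Bool) → Bool` with `W_g = 32u`, all `u(x)` odd:
`Φ(f,g) ≤ 121/128`.  Finite-slice statement; NOT summit progress. [this work] -/
theorem typeO_forrelation_le_121_fin14 : ∀ f g : (Fin 14 → Bool) → Bool, IsDegLeFun 3 f → IsDegLeFun 3 g →
    ∀ u : (Fin 14 → Bool) → ℤ, (∀ x, W (fun y => signOf (g y)) x = (2 : ℝ) ^ 5 * (u x : ℝ)) → (∀ x, Odd (u x)) →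
    forrelation f g ≤ 121 / 128 :=
  fun f g hf hg u hu hodd => typeO_forrelation_le_121 f g hf hg u hu hodd


end Summit.QuantumAdvantage.QuantumAdvantage.Theorems.NearExactIsExact.Negative.TypeOOneTwentyOneFourteen

end
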